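import Summits.BirchSwinnertonDyer.BirchSwinnertonDyer.Theorems.ErratumRoadFiveX11aLowerHalfRamCongruence
import HarnessLib

/-!
# The bad primes of a `p`-congruent partner, `p ≥ 5`: reduction types are transported along
# `E[p] ≃ E'[p]` away from `p`, up to UNRAMIFIED-Steinberg (level-raising) primes — the partner anatomy
# of the congruence roads on leaf `ClassX11a` (cell `bsd-print-x11a`, prover seat p2; THEOREMS ONLY,
# 0 named facts; sequel of `ErratumRoadFiveX11aLowerHalfRamCongruence.lean`, p533324)

WHY. Every congruence road on the X11a leaf (`r_an = 0`, `p ‖ N`, `E[p]` irreducible, no (ram)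
prime) reads `BSD_p` of the target `W` off a `p`-congruent PARTNER `G` — a level-raised form
(Ribet / Diamond–Taylor, seat p2's sentence), a level-lowered one (p4), a Hida member (p1), or the
good-ordinary seed of Fouquet 2025 Thm 4.1 with Burungale–Castella–Skinner 2025 (ty2's closing forms
`X11a.bsdp_of_fouquet_bcsSeed{,_sigma}`). The Fouquet road over the enlarged set `Σ = primes(p·N_W·N_G)`
needs Fouquet's Ass. 3.4 at every prime of `Σ ∖ Σ(ρ̄)`, and the tree types that assumption only at
TATE primes of the partner (`Fouquet2025.Assumption34TateAt p G`). This file proves, for `p ≥ 5` and a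
`Γ_ℚ`-equivariant `e : W[p] ≃ G[p]` (globally minimal elliptic `W, G /ℚ`), that nothing else can
occur — the local anatomy of a partner at a prime `ℓ ≠ p` is determined by that of `W` up to
unramified Steinberg primes:

* `W` good at `ℓ` ⟹ `G` good at `ℓ`, or multiplicative with `p ∣ ord_ℓ(Δ_min(G))`
  (`good_or_mult_dvd_of_torsionIso_of_good`: the extra bad primes of a partner are LEVEL-RAISING
  primes — `G[p]` unramified, Ribet's shape);
* `W` multiplicative at `ℓ` with `p ∣ ord_ℓ(Δ_min(W))` ⟹ the same dichotomy for `G`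
  (`good_or_mult_dvd_of_torsionIso_of_mult_dvd`: level-LOWERING / raising at an unramified Steinberg
  prime);
* `W` multiplicative with `p ∤ ord_ℓ(Δ_min(W))` ⟹ `G` the same (`ram_of_torsionIso`, previous file);
* `W` additive at `ℓ` ⟹ `G` additive at `ℓ` (`hasAdditiveReductionAt_of_torsionIso_of_additive`).

So on the Fouquet `Σ`-road the only partner-side local condition beyond `W`'s own is the Tate-prime
clause at the level-raising primes (and Ass. 3.4's "`ℓ` odd" forbids raising the level at `2`:
`dvd_of_torsionIso_of_good_of_mult` — a partner of a curve good at `2` that is multiplicative at `2`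
is level-raised there, cf. ty2's wall `not_assumption34TateAt_of_mult_two`); and additive primes of `W`
never become Steinberg primes of a partner (no (ram) can be "acquired" there either, completing
`ram_iff_of_torsionIso`). All inputs are §1–§2 of the previous file (PROVED tree theorems: Tate
curve, Serre 1972 n° 1.12, *AEC* VII.4.1, Kodaira–Néron `c_ℓ ≤ 4`) plus `#E[p] = p²`.

Beyond-print theorem: NO (Carayol / Ribet level arithmetic of `ρ̄` read on elliptic curves; Serre
1987 §4, Diamond–Taylor 1994 §1); kernel bookkeeping for the partner roads of items 19064
(`X11aLowerHalf`) and the cell's PrintX11a route.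

References: [SerreInventiones1972] §1.11–1.12; [Serre1987] §4.1; [DiamondTaylor1994] Thm. A (level
raising keeps `ρ̄`, new primes are unramified Steinberg); [Fouquet2025EquivariantTNC] Ass. 3.4 (pp. 22–23);
[SilvermanAEC2009] VII.4.1, VII.6.1; cell STATUS 2026-08-27 (p2, ty2 §E).
-/

set_option autoImplicit false
set_option linter.dupNamespace false -- the directory name repeats the summit name (sibling precedent)

noncomputable section

open scoped Classical NNReal

namespace Summit.BirchSwinnertonDyer.BirchSwinnertonDyer.Theorems.RamCongruence

open NumberField IsDedekindDomain Field IsDedekindDomain.HeightOneSpectrum Rat.HeightOneSpectrum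
open WeierstrassCurve Literature.NumberTheory.EllipticCurves
  Literature.NumberTheory.EllipticCurves.Rank1Residual
  Literature.NumberTheory.GaloisRepresentations
  Literature.NumberTheory.GaloisRepresentations.IsNonarchimedeanLocalField
  Summit.BirchSwinnertonDyer.Rank1Residual

variable {W G : WeierstrassCurve ℚ} {p : ℕ} [hp : Fact p.Prime] (v : HeightOneSpectrum (𝓞 ℚ))

/-! ## §1 `E[p]` has a non-zero point; "unramified at `v`" is transported -/

section Basic

variable (W)

/-- `E[p] = E(ℚ̄)[p]` has a non-zero element (`#E[p] = p²`, Silverman *AEC* III.6.4).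
[cite: SilvermanAEC2009, Cor. III.6.4(b)] -/
theorem exists_geomTorsion_ne_zero [W.IsElliptic] : ∃ P : geomTorsion W (p : ℤ), P ≠ 0 := by
  have hcard : Nat.card (geomTorsion W (p : ℤ)) = p ^ 2 :=
    WeierstrassCurve.card_torsionPoints_eq_sq_holds W (AlgebraicClosure ℚ) (n := p)
      (by exact_mod_cast hp.out.ne_zero)
  have h1 : 1 < Nat.card (geomTorsion W (p : ℤ)) := by
    rw [hcard]
    exact Nat.one_lt_pow two_ne_zero hp.out.one_lt
  haveI : Finite (geomTorsion W (p : ℤ)) := Nat.finite_of_card_ne_zero (by omega)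
  haveI : Nontrivial (geomTorsion W (p : ℤ)) := Finite.one_lt_card_iff_nontrivial.mp h1
  exact exists_ne 0

variable {W}

omit hp in
/-- "`E[p]` is unramified at `v`" (the inertia group `I_v ≤ Γ_{ℚ_v}` acts trivially through
`resGal`) passes along a `Γ_ℚ`-equivariant isomorphism `W[p] ≃ G[p]`. [folklore] -/
theorem forall_smul_eq_of_torsionIso
    (e : geomTorsion W (p : ℤ) ≃+ geomTorsion G (p : ℤ))
    (he : ∀ (σ : absoluteGaloisGroup ℚ) (P : geomTorsion W (p : ℤ)), e (σ • P) = σ • e P)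
    (h : ∀ τ ∈ absInertia (v.adicCompletion ℚ), ∀ P : geomTorsion W (p : ℤ),
      resGal (K := ℚ) (v.adicCompletion ℚ) τ • P = P) :
    ∀ τ ∈ absInertia (v.adicCompletion ℚ), ∀ Q : geomTorsion G (p : ℤ),
      resGal (K := ℚ) (v.adicCompletion ℚ) τ • Q = Q := by
  intro τ hτ Q
  have hQ : Q = e (e.symm Q) := (e.apply_symm_apply Q).symm
  rw [hQ, ← he, h τ hτ]

end Basic

/-! ## §2 An unramified `E[p]` at `v ∤ p`, `p ≥ 5`: good, or multiplicative with `p ∣ ord_v(Δ_min)` -/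

section Unramified

variable (W)

/-- **If `E[p]` is unramified at `v ∤ p` (`p ≥ 5`) then `E` is good at `v`, or multiplicative at `v`
with `p ∣ ord_v(Δ_min)`** — additive reduction would kill every inertia-fixed `p`-torsion point
(Kodaira–Néron, `eq_zero_of_fixed_of_additive`) while `E[p] ≠ 0`, and multiplicative reduction with
`p ∤ ord_v(Δ_min)` ramifies `E[p]` (Tate curve, `exists_smul_ne_of_mult_of_not_dvd`).
[cite: SerreInventiones1972, §1.11–1.12] [cite: SilvermanAEC2009, Thm. VII.6.1] -/
theorem good_or_mult_dvd_of_unramified [W.IsElliptic] [W.IsGloballyMinimal] (hp5 : 5 ≤ p)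
    (hpv : (p : 𝓞 ℚ) ∉ v.asIdeal)
    (h : ∀ τ ∈ absInertia (v.adicCompletion ℚ), ∀ P : geomTorsion W (p : ℤ),
      resGal (K := ℚ) (v.adicCompletion ℚ) τ • P = P) :
    W.HasGoodReductionAt v ∨ (W.HasMultiplicativeReductionAt v ∧ p ∣ W.ordMinimalDiscriminant v) := by
  rcases W.hasGoodReductionAt_or_hasMultiplicativeReductionAt_or_hasAdditiveReductionAt v with
    hg | hm | ha
  · exact Or.inl hg
  · refine Or.inr ⟨hm, ?_⟩
    by_contra hnd
    obtain ⟨τ, hτ, P, hP⟩ := exists_smul_ne_of_mult_of_not_dvd W v hpv hm hnd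
    exact hP (h τ hτ P)
  · exfalso
    obtain ⟨P, hP0⟩ := exists_geomTorsion_ne_zero W (p := p)
    exact hP0 (eq_zero_of_fixed_of_additive W v hp5 hpv ha P (fun τ hτ ↦ h τ hτ P))

/-- **An additive place `v ∤ p` ramifies `E[p]` (`p ≥ 5`)**: some inertia element moves a
`p`-torsion point (else every point is fixed, hence zero by Kodaira–Néron, while `E[p] ≠ 0`).
[cite: SilvermanAEC2009, Thm. VII.6.1 and proof of Thm. VII.7.1] -/
theorem exists_smul_ne_of_additive [W.IsElliptic] (hp5 : 5 ≤ p) (hpv : (p : 𝓞 ℚ) ∉ v.asIdeal)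
    (hadd : W.HasAdditiveReductionAt v) :
    ∃ τ ∈ absInertia (v.adicCompletion ℚ), ∃ P : geomTorsion W (p : ℤ),
      resGal (K := ℚ) (v.adicCompletion ℚ) τ • P ≠ P := by
  by_contra hall
  push Not at hall
  obtain ⟨P, hP0⟩ := exists_geomTorsion_ne_zero W (p := p)
  exact hP0 (eq_zero_of_fixed_of_additive W v hp5 hpv hadd P (fun τ hτ ↦ hall τ hτ P))

end Unramified

/-! ## §3 Transport of the reduction type along `W[p] ≃ G[p]` away from `p` (`p ≥ 5`) -/

section Transport

/-- **Good primes of `W` are good or LEVEL-RAISING primes of a partner** (`p ≥ 5`): if `W` is good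
at `v ∤ p` and `W[p] ≃ G[p]` (`Γ_ℚ`-equivariantly), then `G` is good at `v`, or multiplicative at `v`
with `p ∣ ord_v(Δ_min(G))` (an unramified Steinberg prime: `G[p]` is unramified at `v` like `W[p]`,
Silverman VII.4.1). This is the elliptic-curve shadow of Ribet / Diamond–Taylor level raising: the
new primes of a congruent form carry `ρ̄` unramified. [cite: SilvermanAEC2009, Prop. VII.4.1(a)]
[cite: DiamondTaylor1994, Thm. A] [cite: SerreInventiones1972, §1.12] -/
theorem good_or_mult_dvd_of_torsionIso_of_good [W.IsElliptic] [G.IsElliptic] [G.IsGloballyMinimal]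
    (hp5 : 5 ≤ p) (hpv : (p : 𝓞 ℚ) ∉ v.asIdeal)
    (e : geomTorsion W (p : ℤ) ≃+ geomTorsion G (p : ℤ))
    (he : ∀ (σ : absoluteGaloisGroup ℚ) (P : geomTorsion W (p : ℤ)), e (σ • P) = σ • e P)
    (hgood : W.HasGoodReductionAt v) :
    G.HasGoodReductionAt v ∨ (G.HasMultiplicativeReductionAt v ∧ p ∣ G.ordMinimalDiscriminant v) :=
  good_or_mult_dvd_of_unramified G v hp5 hpv
    (forall_smul_eq_of_torsionIso v e he (fun _ hτ P ↦ smul_eq_of_good W v hpv hgood hτ P))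

/-- **Unramified Steinberg primes of `W` stay good-or-unramified-Steinberg in a partner** (`p ≥ 5`):
if `W` is multiplicative at `v ∤ p` with `p ∣ ord_v(Δ_min(W))` and `W[p] ≃ G[p]`, then `G` is good at
`v` (level lowering) or multiplicative with `p ∣ ord_v(Δ_min(G))` (Serre 1972 n° 1.12 both ways).
[cite: SerreInventiones1972, n° 1.12] [cite: Serre1987, §4.1 (4.1.12)] -/
theorem good_or_mult_dvd_of_torsionIso_of_mult_dvd [W.IsElliptic] [G.IsElliptic]
    [G.IsGloballyMinimal] (hp5 : 5 ≤ p) (hpv : (p : 𝓞 ℚ) ∉ v.asIdeal)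
    (e : geomTorsion W (p : ℤ) ≃+ geomTorsion G (p : ℤ))
    (he : ∀ (σ : absoluteGaloisGroup ℚ) (P : geomTorsion W (p : ℤ)), e (σ • P) = σ • e P)
    (hmult : W.HasMultiplicativeReductionAt v) (hdvd : p ∣ W.ordMinimalDiscriminant v) :
    G.HasGoodReductionAt v ∨ (G.HasMultiplicativeReductionAt v ∧ p ∣ G.ordMinimalDiscriminant v) :=
  good_or_mult_dvd_of_unramified G v hp5 hpv
    (forall_smul_eq_of_torsionIso v e he
      (fun _ hτ P ↦ smul_eq_of_mult_of_dvd W v hpv hmult hdvd hτ P))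

/-- **Additive primes are congruence invariants** (`p ≥ 5`): if `W` is additive at `v ∤ p` and
`W[p] ≃ G[p]`, then `G` is additive at `v` — `G[p]` is ramified at `v` (so `G` is not good) and has
no non-zero inertia-fixed vector (so `G` is not multiplicative: Tate basis,
`exists_fixed_ne_zero_of_mult`). In particular an additive prime of an X11a curve is never a
Steinberg prime of a partner, so no (ram) prime is acquired there.
[cite: SilvermanAEC2009, Thm. VII.6.1] [cite: SilvermanATAEC1994, V.4–V.5 (Tate curve)] -/
theorem hasAdditiveReductionAt_of_torsionIso_of_additive [W.IsElliptic] [G.IsElliptic] (hp5 : 5 ≤ p)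
    (hpv : (p : 𝓞 ℚ) ∉ v.asIdeal) (e : geomTorsion W (p : ℤ) ≃+ geomTorsion G (p : ℤ))
    (he : ∀ (σ : absoluteGaloisGroup ℚ) (P : geomTorsion W (p : ℤ)), e (σ • P) = σ • e P)
    (hadd : W.HasAdditiveReductionAt v) : G.HasAdditiveReductionAt v := by
  rcases G.hasGoodReductionAt_or_hasMultiplicativeReductionAt_or_hasAdditiveReductionAt v with
    hg | hm | ha
  · exfalso
    obtain ⟨τ, hτ, Q, hQ⟩ :=
      exists_smul_ne_of_torsionIso v e he (exists_smul_ne_of_additive W v hp5 hpv hadd)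
    exact hQ (smul_eq_of_good G v hpv hg hτ Q)
  · exfalso
    -- a non-zero inertia-fixed vector of `G[p]` pulls back to one of `W[p]`, impossible
    obtain ⟨P, hP0, hP⟩ := exists_fixed_ne_zero_of_torsionIso v e.symm (torsionIso_symm_smul e he)
      (exists_fixed_ne_zero_of_mult G v hpv hm)
    exact hP0 (eq_zero_of_fixed_of_additive W v hp5 hpv hadd P hP)
  · exact ha

/-- **A partner of a curve good at `ℓ = 2` is never multiplicative at `2`** unless it raises the
level there — and then Fouquet's Ass. 3.4 ("`ℓ ∈ Σ ∖ Σ(ρ̄)` is odd") fails; recorded as: if `W` is good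
at the place `v` of `2` (`p ≥ 5`) and `G` is multiplicative at `v`, then `p ∣ ord_v(Δ_min(G))`, i.e.
`v` IS a level-raising prime of `G` (so ty2's wall `not_assumption34TateAt_of_mult_two` applies to
`G`). [cite: Fouquet2025EquivariantTNC, Ass. 3.4 (pp. 22–23)] -/
theorem dvd_of_torsionIso_of_good_of_mult [W.IsElliptic] [G.IsElliptic] [G.IsGloballyMinimal]
    (hp5 : 5 ≤ p) (hpv : (p : 𝓞 ℚ) ∉ v.asIdeal)
    (e : geomTorsion W (p : ℤ) ≃+ geomTorsion G (p : ℤ))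
    (he : ∀ (σ : absoluteGaloisGroup ℚ) (P : geomTorsion W (p : ℤ)), e (σ • P) = σ • e P)
    (hgood : W.HasGoodReductionAt v) (hm : G.HasMultiplicativeReductionAt v) :
    p ∣ G.ordMinimalDiscriminant v := by
  rcases good_or_mult_dvd_of_torsionIso_of_good v hp5 hpv e he hgood with hg | ⟨-, hdvd⟩
  · exact absurd hg hm.not_hasGoodReductionAt
  · exact hdvd

/-- **Semistability at `v ∤ p` is a congruence invariant** (`p ≥ 5`): `W` semistable at `v` iff `G`
is, for `W[p] ≃ G[p]`. [cite: SerreInventiones1972, §1.11–1.12] [cite: SilvermanAEC2009, Thm. VII.6.1] -/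
theorem isSemistableAt_iff_of_torsionIso [W.IsElliptic] [G.IsElliptic] (hp5 : 5 ≤ p) (hpv : (p : 𝓞 ℚ) ∉ v.asIdeal)
    (e : geomTorsion W (p : ℤ) ≃+ geomTorsion G (p : ℤ))
    (he : ∀ (σ : absoluteGaloisGroup ℚ) (P : geomTorsion W (p : ℤ)), e (σ • P) = σ • e P) :
    W.IsSemistableAt v ↔ G.IsSemistableAt v := by
  rw [W.isSemistableAt_iff_not_hasAdditiveReductionAt, G.isSemistableAt_iff_not_hasAdditiveReductionAt]
  exact ⟨fun hW hG ↦ hW (hasAdditiveReductionAt_of_torsionIso_of_additive v hp5 hpv e.symm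
      (torsionIso_symm_smul e he) hG),
    fun hG hW ↦ hG (hasAdditiveReductionAt_of_torsionIso_of_additive v hp5 hpv e he hW)⟩

end Transport

/-! ## §4 The X11a reading: partner anatomy on the leaf -/

section X11a

variable [W.IsElliptic] [W.IsGloballyMinimal] [G.IsElliptic] [G.IsGloballyMinimal]

/-- **Partner anatomy on leaf X11a** (`p ≥ 5`): for `(W, p) ∈ ClassX11a` and a `Γ_ℚ`-congruent
globally minimal elliptic `G` (`W[p] ≃ G[p]`), at every place `v ∤ p`: EITHER `W` is additive at `v`
and so is `G`, OR `G` is good at `v`, OR `G` is multiplicative at `v` with `p ∣ ord_v(Δ_min(G))`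
(`G[p]` unramified). Hence every Steinberg prime `ℓ ≠ p` of a partner is an UNRAMIFIED one (no (ram):
`not_ram_of_torsionIso`), and the only partner-side local conditions of the Fouquet `Σ`-road are the
Tate-prime clauses of `Fouquet2025.Assumption34TateAt p G` at those primes.
[cite: Fouquet2025EquivariantTNC, Ass. 3.4 (pp. 22–23), Thm 4.1] [cite: SerreInventiones1972, §1.12] -/
theorem partner_anatomy_of_classX11a (hp5 : 5 ≤ p) (hX : ClassX11a W p)
    (e : geomTorsion W (p : ℤ) ≃+ geomTorsion G (p : ℤ))
    (he : ∀ (σ : absoluteGaloisGroup ℚ) (P : geomTorsion W (p : ℤ)), e (σ • P) = σ • e P)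
    (hpv : (p : 𝓞 ℚ) ∉ v.asIdeal) :
    (W.HasAdditiveReductionAt v ∧ G.HasAdditiveReductionAt v) ∨ G.HasGoodReductionAt v ∨
      (G.HasMultiplicativeReductionAt v ∧ p ∣ G.ordMinimalDiscriminant v) := by
  rcases W.hasGoodReductionAt_or_hasMultiplicativeReductionAt_or_hasAdditiveReductionAt v with
    hg | hm | ha
  · exact Or.inr (good_or_mult_dvd_of_torsionIso_of_good v hp5 hpv e he hg)
  · -- `W` multiplicative at `v ∤ p`: on X11a it is an unramified Steinberg prime (`¬ Ram W p`)
    have hdvd : p ∣ W.ordMinimalDiscriminant v := by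
      by_contra hnd
      exact hX.2.2.2.2 ((ram_iff_exists_place).mpr ⟨v, hpv, hm, hnd⟩)
    exact Or.inr (good_or_mult_dvd_of_torsionIso_of_mult_dvd v hp5 hpv e he hm hdvd)
  · exact Or.inl ⟨ha, hasAdditiveReductionAt_of_torsionIso_of_additive v hp5 hpv e he ha⟩

end X11a

end Summit.BirchSwinnertonDyer.BirchSwinnertonDyer.Theorems.RamCongruence

end
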